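import Mathlib.Logic.Hydra
import Mathlib.Data.List.GetD
import Mathlib.Tactic
import HarnessLib

/-!
# [OURS · decomp-res lens-2 g22 · column 29273 `MaxContactCut.RungOne` · node «DeepCrossCut» (g21 rev7/rev8)] THE
FAN GAME OF LAW (X**) IN KERNEL:
# LEMMA Y.C's local table, (T1) STRADDLING, (T4) THE TERMINATION THEOREM (Dershowitz–Manna decrease of the measure
`M(Σ)` at every (P2) move of
# the greedy intrinsic strategy S3′ + well-foundedness), S3′ AS A PROGRAM ON FANS, and 35 EXIT CERTIFICATES `ℓ(m,d)`
by kernel evaluation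

decomp-res-lens-2 g22 (planner seat; critic window g22 = CRITIC-LEDGER row 168/175 MAP (b′) «KERNEL PORT of the fan
game + (T4): `structure Fan`,
`step`, `measure : Fan → Multiset ℕ`, the (T4) key step, Dershowitz–Manna well-foundedness, `decide` certificates
for a stated `(m,d)` table»).
Companion of the HOME node `HOME/decomp-res-lens-2/g22/DeepCrossCut.lean` (§Y.1 (X**): LEMMA Y.C, (T1)–(T5) on
paper); landable by the cell's
writer as `Theorems/DeepCrossCutFanGame*.lean` with `--supports stmt-ResolutionOfSingularities-29273` (helper;
imports Mathlib only; sorry-free,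
fact-free; every certificate by `decide +kernel`, no `native_decide`, no extra axioms).  OURS; AI kernel work,
weaker than expert review; NOT a
statement of any manuscript; resolution of singularities in characteristic `p` is NOT proved here or anywhere in this chain.

## What is proved IN KERNEL here, and what stays on paper

KERNEL (this file, 0 sorry):
* §1–§2 THE LOCAL TABLE of LEMMA Y.C: a ray of a fan over the tangle point carries the local datum `(δ, x, y, t)` —
`δ = ord_D(x^A) − ord_D(x^B)`
  (`A = (m,0,0)`, `B = (0,d,2)`, `m`, `d` odd) and the parities of its three coordinates (`Ray`, `Ray.WF`: `δ ≡ x +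
y (mod 2)` is the bed's parity
  law); the REDUCED orders `(a, b) = (|α|_D, |β|_D)` of the two accumulated monomials after factoring the maximal
square (`Ray.a`, `Ray.b`: the
  three sign cases of LEMMA Y.C (i)); the new ray of a star subdivision `u = v + w` (`Ray.add`: `δ` adds, parities
add); TOP LINE / SPECIAL
  (`τ = 1`) edge (LEMMA Y.C (ii): `|a| ≥ 2 ∧ |b| ≥ 2`, and neither reduced pair is `(1,1)`), ORDER `min(|a|,|b|)`,
WEIGHT `W = max(|δ_v|,|δ_w|)`,
  S3′'s KEY `(order, |δ_v|+|δ_w|)` (`KeyLE`).  (T1) `straddle_of_special`: a special edge has `δ_v > 0 > δ_w` up to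
order (so no special edge
  touches the hyperplane `δ = 0`, `not_special_of_δ_zero`, and the new ray lies strictly between,
`δ_add_between_of_special`).  (T4) KEY LEMMA
  `weight_lt_of_new_edge`: if the special edge `{v,w}` is KEY-MAXIMAL against the two other edges `{v,z}`, `{w,z}`
of a cone on it, then each
  of the three edges through the new ray `u = v + w` that is special has weight `< W{v,w}` — NO unimodularity
hypothesis is needed (this is
  `explore/keylemma3.py`'s enumeration made a theorem: 39072 local configurations, 0 violations, now `omega`).
* §3 INDEXED FANS (`Fan` = list of rays + list of cones as index triples; `Fan.subdivide` = star subdivision of an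
edge: the new ray is
  appended, every cone on the edge splits in two through its third vertex) and the EDGE BOOKKEEPING `Fan.mem_edges_subdivide` /
  `Fan.mem_edges_subdivide_of_mem` / `Fan.subdivide_valid`: after subdividing `{p,q}` the edges are the old edges
except `{p,q}` plus edges
  through the new ray whose other end is `p`, `q` or a third vertex of a cone on `{p,q}`.
* §4 (T4) THE TERMINATION THEOREM: `Fan.measure F : Multiset ℕ` = the weights of the special edges;
`Fan.cutExpand_measure_subdivide`: a (P2)
  move of S3′ (subdivide a special edge of maximal key, `Fan.IsMaxSpecial`) replaces `M` by a multiset SMALLER IN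
THE DERSHOWITZ–MANNA ORDER
  (Mathlib's `Relation.CutExpand (· < ·)`: one weight removed, finitely many strictly smaller ones added);
`Fan.wellFounded_P2Step`: the (P2)
  move relation is WELL FOUNDED (`WellFounded.cutExpand`), `Fan.no_infinite_P2_run`.
* §5 S3′ AS A PROGRAM (`Fan.step`: (P2) a special edge of maximal key ≻ (P3) at a special point a top-line edge of
maximal order ≻ (P3n) a nodal
  edge ≻ stop; ties by list order, which S3′ leaves free), `Fan.isMaxSpecial_of_p2` / `Fan.P2Step_of_p2` (the
program's (P2) choice IS a (P2)
  move, so §4 governs that phase), EXIT (`Fan.Exit` = LEMMA Y.C (v): no special edge, no special point, no nodal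
edge), `Fan.run` with fuel and
  its soundness `Fan.run_sound` (`run F fuel = some k` ⇒ after exactly `k` moves the program is at an EXIT state),
the initial fan `Fan.init m d`
  of the bed member `z² + x^m + t²y^d` (`Fan.init_valid`, `Fan.isSpecial_init`: the first move is forced), and the
35 EXIT CERTIFICATES
  `Fan.run_init_m_d : (init m d).run 40 = some ℓ` for every odd `3 ≤ m ≤ 11`, `m ≤ d ≤ m + 12`, each by `decide
+kernel` — the table
  `ℓ(3,·) = 2,7,3,4,9,5,6 · ℓ(5,·) = 3,7,10,4,13,5,9 · ℓ(7,·) = 4,15,18,13,5,9,10 · ℓ(9,·) = 5,17,10,11,16,6,13 ·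
ℓ(11,·) = 6,27,14,32,12,19,7`
  — `ℓ` counts the LINE blow-ups (P2)+(P3)+(P3n); the node's `explore/combi.py` table (§Y.1 EVIDENCE (a):
`2,7,4,5,10,7,8 · 4,9,12,…`)
  additionally counts the (P1) PLANE blow-ups (`⌊min(|α_u|,|β_u|)/2⌋` order-`2` divisors through a new ray, which
LEMMA Y.C (i) absorbs into
  the REDUCED local table used here): on all 35 pairs the (P2) counts agree exactly and `steps = ℓ + #(P1)` on the
32 tie-free pairs; at the
  three tie pairs `(7,11)`, `(9,15)`, `(11,17)` combi.py's other peel order plays `1, 1, 5` more (P3) moves — only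
the (P3) peel counts
  depend on the tie-break S3′ leaves free, as (T2) allows (`explore/localgame.py` is the exact Python twin of §5 for
such replays).
PAPER (node §Y.1, NOT proved here): LEMMA Y.C itself = that this game IS the run of S3′ on the bed (the
ideal-theoretic meaning of `a`, `b`,
special, exit: needs scheme-level blow-up charts for `PackageExitsOver`), (T2) the PEEL LEMMA (the (P3)/(P3n) phase
is finite — here only
witnessed by the certificates), (T5) the TAIL LEMMA, and the step from the bed to `DeepCrossExit`.
SCOPE: the local data forget the vectors of the rays (conservative for termination: the kernel theorem quantifies
over ALL valid indexed fans,
a superset of the geometric ones); «over `T`» is automatic (every ray of the game lies over the tangle point);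
residue characteristic `2` is
where LEMMA Y.C reads this table off the bed — the combinatorics below is characteristic-free.
-/


namespace Summit.ResolutionOfSingularities.ResolutionOfSingularities.Theorems.DeepCrossCutFanGame


/-! ## §1  The local table of LEMMA Y.C: rays, reduced orders, the new ray -/

/-- LOCAL DATUM OF A RAY `D` over the tangle point: `δ = ord_D(x^A) − ord_D(x^B)` and the parities `x, y, t ∈ {0,1}`
of its three coordinates.
[OURS · bookkeeping] -/
structure Ray where
  δ : ℤ
  x : ℤ
  y : ℤ
  t : ℤ
deriving DecidableEq, Repr, Inhabited

namespace Ray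

/-- WELL-FORMED datum: parities are bits and `δ ≡ x + y (mod 2)` (the bed's parity law: `A − B = (m, −d, −2)` with
`m`, `d` odd). [OURS · bookkeeping] -/
def WF (v : Ray) : Prop :=
  0 ≤ v.x ∧ v.x ≤ 1 ∧ 0 ≤ v.y ∧ v.y ≤ 1 ∧ 0 ≤ v.t ∧ v.t ≤ 1 ∧ (v.δ - v.x - v.y) % 2 = 0

/-- Decidability / bookkeeping instance of the fan-game kernel, VERBATIM from the lens's part file (see the module docstring). [folklore] -/
instance (v : Ray) : Decidable v.WF := by unfold WF; infer_instance

/-- REDUCED ORDER `|α|_D` of the first accumulated monomial (LEMMA Y.C (i): `δ + y` if `δ > 0`, else the bit `x`).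
[OURS · bookkeeping] -/
def a (v : Ray) : ℤ := if 0 < v.δ then v.δ + v.y else v.x
/-- REDUCED ORDER `|β|_D` of the second accumulated monomial (LEMMA Y.C (i): `x − δ` if `δ < 0`, `y` if `δ > 0`, the
bit `x` on `δ = 0`).
[OURS · bookkeeping] -/
def b (v : Ray) : ℤ := if v.δ < 0 then v.x - v.δ else (if 0 < v.δ then v.y else v.x)

/-- THE NEW RAY `u = v + w` of a star subdivision: `δ` is additive, parities add. [OURS · bookkeeping] -/
def add (v w : Ray) : Ray := ⟨v.δ + w.δ, (v.x + w.x) % 2, (v.y + w.y) % 2, (v.t + w.t) % 2⟩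

/-- `add_δ`: Auxiliary step of the fan-game kernel (decomp-res lens-2 g22 «DeepCrossCut» companion FanGame.lean
16455400), VERBATIM from the lens's part file (see the module docstring); the statement is its type. [folklore] -/
@[simp] theorem add_δ (v w : Ray) : (v.add w).δ = v.δ + w.δ := rfl
/-- `add_x`: Auxiliary step of the fan-game kernel (decomp-res lens-2 g22 «DeepCrossCut» companion FanGame.lean
16455400), VERBATIM from the lens's part file (see the module docstring); the statement is its type. [folklore] -/
@[simp] theorem add_x (v w : Ray) : (v.add w).x = (v.x + w.x) % 2 := rfl
/-- `add_y`: Auxiliary step of the fan-game kernel (decomp-res lens-2 g22 «DeepCrossCut» companion FanGame.lean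
16455400), VERBATIM from the lens's part file (see the module docstring); the statement is its type. [folklore] -/
@[simp] theorem add_y (v w : Ray) : (v.add w).y = (v.y + w.y) % 2 := rfl
/-- `add_t`: Auxiliary step of the fan-game kernel (decomp-res lens-2 g22 «DeepCrossCut» companion FanGame.lean
16455400), VERBATIM from the lens's part file (see the module docstring); the statement is its type. [folklore] -/
@[simp] theorem add_t (v w : Ray) : (v.add w).t = (v.t + w.t) % 2 := rfl

/-- `ab_of_pos`: Auxiliary step of the fan-game kernel (decomp-res lens-2 g22 «DeepCrossCut» companion FanGame.lean
16455400), VERBATIM from the lens's part file (see the module docstring); the statement is its type. [folklore] -/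
theorem ab_of_pos {v : Ray} (h : 0 < v.δ) : v.a = v.δ + v.y ∧ v.b = v.y := by
  unfold a b; constructor <;> split_ifs <;> omega
/-- `ab_of_neg`: Auxiliary step of the fan-game kernel (decomp-res lens-2 g22 «DeepCrossCut» companion FanGame.lean
16455400), VERBATIM from the lens's part file (see the module docstring); the statement is its type. [folklore] -/
theorem ab_of_neg {v : Ray} (h : v.δ < 0) : v.a = v.x ∧ v.b = v.x - v.δ := by
  unfold a b; constructor <;> split_ifs <;> omega
/-- `ab_of_zero`: Auxiliary step of the fan-game kernel (decomp-res lens-2 g22 «DeepCrossCut» companion FanGame.lean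
16455400), VERBATIM from the lens's part file (see the module docstring); the statement is its type. [folklore] -/
theorem ab_of_zero {v : Ray} (h : v.δ = 0) : v.a = v.x ∧ v.b = v.x := by
  unfold a b; constructor <;> split_ifs <;> omega

/-- the three sign cases packaged: usable as `obtain ⟨h, ha, hb⟩ | ⟨h, ha, hb⟩ | ⟨h, ha, hb⟩ := v.trichotomy`. [folklore] -/
theorem trichotomy (v : Ray) :
    (0 < v.δ ∧ v.a = v.δ + v.y ∧ v.b = v.y) ∨ (v.δ < 0 ∧ v.a = v.x ∧ v.b = v.x - v.δ) ∨
    (v.δ = 0 ∧ v.a = v.x ∧ v.b = v.x) := by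
  rcases lt_trichotomy 0 v.δ with h | h | h
  · exact Or.inl ⟨h, ab_of_pos h⟩
  · exact Or.inr (Or.inr ⟨h.symm, ab_of_zero h.symm⟩)
  · exact Or.inr (Or.inl ⟨h, ab_of_neg h⟩)

/-- `add_WF`: Auxiliary step of the fan-game kernel (decomp-res lens-2 g22 «DeepCrossCut» companion FanGame.lean
16455400), VERBATIM from the lens's part file (see the module docstring); the statement is its type. [folklore] -/
theorem add_WF {v w : Ray} (hv : v.WF) (hw : w.WF) : (v.add w).WF := by
  unfold WF at *; simp only [add_δ, add_x, add_y, add_t]; omega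

end Ray

open Ray

/-! ## §2  Top lines, special (`τ = 1`) lines, the key of S3′; (T1) straddling and the (T4) key lemma -/

/-- TOP LINE `{v,w}` (LEMMA Y.C (ii)): `|a_v| + |a_w| ≥ 2 ∧ |b_v| + |b_w| ≥ 2` (the line lies in the order-`2`
locus). [OURS · bookkeeping] -/
def TopLine (v w : Ray) : Prop := 2 ≤ v.a + w.a ∧ 2 ≤ v.b + w.b
/-- SPECIAL (`τ = 1`) LINE (LEMMA Y.C (ii)): a top line neither of whose reduced pairs is `(1,1)`. [OURS · bookkeeping] -/
def Special (v w : Ray) : Prop :=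
  2 ≤ v.a + w.a ∧ 2 ≤ v.b + w.b ∧ ¬ (v.a = 1 ∧ w.a = 1) ∧ ¬ (v.b = 1 ∧ w.b = 1)
/-- GENERIC ORDER along the line: `min(|a|, |b|)`. [OURS · bookkeeping] -/
def order (v w : Ray) : ℤ := min (v.a + w.a) (v.b + w.b)
/-- THE WEIGHT `W{v,w} = max(|δ_v|, |δ_w|)` of (T4). [OURS · bookkeeping] -/
def weight (v w : Ray) : ℕ := max v.δ.natAbs w.δ.natAbs
/-- S3′'s tie-break `|δ_v| + |δ_w|`. [OURS · bookkeeping] -/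
def ssum (v w : Ray) : ℕ := v.δ.natAbs + w.δ.natAbs

/-- Decidability / bookkeeping instance of the fan-game kernel, VERBATIM from the lens's part file (see the module docstring). [folklore] -/
instance (v w : Ray) : Decidable (TopLine v w) := by unfold TopLine; infer_instance
/-- Decidability / bookkeeping instance of the fan-game kernel, VERBATIM from the lens's part file (see the module docstring). [folklore] -/
instance (v w : Ray) : Decidable (Special v w) := by unfold Special; infer_instance

/-- `special_comm`: Auxiliary step of the fan-game kernel (decomp-res lens-2 g22 «DeepCrossCut» companion
FanGame.lean 16455400), VERBATIM from the lens's part file (see the module docstring); the statement is its type. [folklore] -/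
theorem special_comm {v w : Ray} : Special v w ↔ Special w v := by
  unfold Special; omega
/-- `order_comm`: Auxiliary step of the fan-game kernel (decomp-res lens-2 g22 «DeepCrossCut» companion FanGame.lean
16455400), VERBATIM from the lens's part file (see the module docstring); the statement is its type. [folklore] -/
theorem order_comm (v w : Ray) : order v w = order w v := by unfold order; omega
/-- `weight_comm`: Auxiliary step of the fan-game kernel (decomp-res lens-2 g22 «DeepCrossCut» companion
FanGame.lean 16455400), VERBATIM from the lens's part file (see the module docstring); the statement is its type. [folklore] -/
theorem weight_comm (v w : Ray) : weight v w = weight w v := by unfold weight; omega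
/-- `ssum_comm`: Auxiliary step of the fan-game kernel (decomp-res lens-2 g22 «DeepCrossCut» companion FanGame.lean
16455400), VERBATIM from the lens's part file (see the module docstring); the statement is its type. [folklore] -/
theorem ssum_comm (v w : Ray) : ssum v w = ssum w v := by unfold ssum; omega

/-- `topLine_of_special`: Auxiliary step of the fan-game kernel (decomp-res lens-2 g22 «DeepCrossCut» companion
FanGame.lean 16455400), VERBATIM from the lens's part file (see the module docstring); the statement is its type. [folklore] -/
theorem topLine_of_special {v w : Ray} (h : Special v w) : TopLine v w := ⟨h.1, h.2.1⟩

/-- **(T1) SPECIAL ⇒ STRICTLY STRADDLING**: a special line joins a ray with `δ > 0` to a ray with `δ < 0`. [OURS] [folklore] -/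
theorem straddle_of_special {v w : Ray} (hv : v.WF) (hw : w.WF) (h : Special v w) :
    (0 < v.δ ∧ w.δ < 0) ∨ (v.δ < 0 ∧ 0 < w.δ) := by
  unfold Special at h
  unfold Ray.WF at hv hw
  obtain ⟨h1, ha1, hb1⟩ | ⟨h1, ha1, hb1⟩ | ⟨h1, ha1, hb1⟩ := v.trichotomy <;>
  obtain ⟨h2, ha2, hb2⟩ | ⟨h2, ha2, hb2⟩ | ⟨h2, ha2, hb2⟩ := w.trichotomy <;>
  omega

/-- (T1) corollary: the new ray of a special line lies STRICTLY BETWEEN its ends in `δ`. [OURS] [folklore] -/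
theorem δ_add_between_of_special {v w : Ray} (hv : v.WF) (hw : w.WF) (h : Special v w) :
    min v.δ w.δ < (v.add w).δ ∧ (v.add w).δ < max v.δ w.δ := by
  rw [add_δ]; rcases straddle_of_special hv hw h with ⟨h1, h2⟩ | ⟨h1, h2⟩ <;> omega

/-- S3′'s KEY ORDER on lines: `(order, |δ|+|δ′|)` lexicographic, `KeyLE e′ e` = «`e′` is not preferred to `e`».
[OURS · bookkeeping] -/
def KeyLE (v' w' v w : Ray) : Prop :=
  order v' w' < order v w ∨ (order v' w' = order v w ∧ ssum v' w' ≤ ssum v w)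

/-- (T4) KEY LEMMA, endpoint edges `{v,u}`, `{u,w}` (`u = v + w`): weight `< W{v,w}` whenever special. [OURS] [folklore] -/
theorem weight_lt_of_special_endpoint {v w : Ray} (hv : v.WF) (hw : w.WF) (hδv : 0 < v.δ) (hδw : w.δ < 0)
    (_he : Special v w) :
    (Special v (v.add w) → weight v (v.add w) < weight v w) ∧
    (Special (v.add w) w → weight (v.add w) w < weight v w) := by
  unfold Special weight at *
  unfold Ray.WF at hv hw
  obtain ⟨hav, hbv⟩ := ab_of_pos hδv
  obtain ⟨haw, hbw⟩ := ab_of_neg hδw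
  obtain ⟨h3, ha3, hb3⟩ | ⟨h3, ha3, hb3⟩ | ⟨h3, ha3, hb3⟩ := (v.add w).trichotomy <;>
  simp only [add_δ, add_x, add_y] at h3 ha3 hb3 ⊢ <;>
  constructor <;> intro h <;> omega

/-- No special edge has an endpoint on `H` (half of (T1)). [folklore] -/
theorem not_special_of_δ_zero {u z : Ray} (hu : u.WF) (hz : z.WF) (h0 : u.δ = 0) : ¬ Special u z := by
  unfold Special Ray.WF at *
  obtain ⟨hau, hbu⟩ := ab_of_zero h0
  obtain ⟨h4, ha4, hb4⟩ | ⟨h4, ha4, hb4⟩ | ⟨h4, ha4, hb4⟩ := z.trichotomy <;> omega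

/-- (T4) KEY STEP on the positive side: `u = v + w` with `δ_u > 0` (so `D = v` carries the weight); only the maximality against
`{v,z}` is used, and only to exclude `|δ_z| ≥ W`. [folklore] -/
theorem weight_lt_of_special_side_pos {v w z : Ray} (hv : v.WF) (hw : w.WF) (hz : z.WF) (hδv : 0 < v.δ) (hδw : w.δ < 0)
    (hu : 0 < v.δ + w.δ) (hmv : Special v z → KeyLE v z v w)
    (hs : Special (v.add w) z) : weight (v.add w) z < weight v w := by
  have hu' : 0 < (v.add w).δ := by rw [add_δ]; exact hu
  obtain ⟨hau, hbu⟩ := ab_of_pos hu'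
  obtain ⟨hav, hbv⟩ := ab_of_pos hδv
  obtain ⟨haw, hbw⟩ := ab_of_neg hδw
  rw [add_y] at hau hbu
  obtain ⟨hvx0, hvx1, hvy0, hvy1, -, -, -⟩ := hv
  obtain ⟨hwx0, hwx1, hwy0, hwy1, -, -, -⟩ := hw
  obtain ⟨hzx0, hzx1, hzy0, hzy1, -, -, -⟩ := hz
  unfold weight; rw [add_δ]
  unfold Special at hs; rw [hau, hbu] at hs
  obtain ⟨h4, ha4, hb4⟩ | ⟨h4, ha4, hb4⟩ | ⟨h4, ha4, hb4⟩ := z.trichotomy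
  · exfalso; rw [ha4, hb4] at hs; clear hmv; omega
  · rw [ha4, hb4] at hs
    by_contra hcon
    -- then `{v,z}` is special and beats `e` in S3′'s key: contradiction with maximality
    have hvz : Special v z := by unfold Special; rw [hav, hbv, ha4, hb4]; clear hmv hs; omega
    have hk := hmv hvz
    clear hmv hvz hs
    unfold KeyLE order ssum at hk
    rw [hav, hbv, ha4, hb4, haw, hbw] at hk
    omega
  · exfalso; rw [ha4, hb4] at hs; clear hmv; omega

/-- (T4) KEY STEP on the negative side: `δ_u < 0` (`D = w`); only the maximality against `{w,z}` is used. [folklore] -/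
theorem weight_lt_of_special_side_neg {v w z : Ray} (hv : v.WF) (hw : w.WF) (hz : z.WF) (hδv : 0 < v.δ) (hδw : w.δ < 0)
    (hu : v.δ + w.δ < 0) (hmw : Special w z → KeyLE w z v w)
    (hs : Special (v.add w) z) : weight (v.add w) z < weight v w := by
  have hu' : (v.add w).δ < 0 := by rw [add_δ]; exact hu
  obtain ⟨hau, hbu⟩ := ab_of_neg hu'
  obtain ⟨hav, hbv⟩ := ab_of_pos hδv
  obtain ⟨haw, hbw⟩ := ab_of_neg hδw
  rw [add_x] at hau hbu; rw [add_δ] at hbu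
  obtain ⟨hvx0, hvx1, hvy0, hvy1, -, -, -⟩ := hv
  obtain ⟨hwx0, hwx1, hwy0, hwy1, -, -, -⟩ := hw
  obtain ⟨hzx0, hzx1, hzy0, hzy1, -, -, -⟩ := hz
  unfold weight; rw [add_δ]
  unfold Special at hs; rw [hau, hbu] at hs
  obtain ⟨h4, ha4, hb4⟩ | ⟨h4, ha4, hb4⟩ | ⟨h4, ha4, hb4⟩ := z.trichotomy
  · rw [ha4, hb4] at hs
    by_contra hcon
    have hwz : Special w z := by unfold Special; rw [haw, hbw, ha4, hb4]; clear hmw hs; omega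
    have hk := hmw hwz
    clear hmw hwz hs
    unfold KeyLE order ssum at hk
    rw [hav, hbv, ha4, hb4, haw, hbw] at hk
    omega
  · exfalso; rw [ha4, hb4] at hs; clear hmw; omega
  · exfalso; rw [ha4, hb4] at hs; clear hmw; omega

/-- (T4) KEY STEP, side edges: if `e = {v,w}` is S3′-maximal against the two edges `{v,z}`, `{w,z}` of a cone on `e`, the side
edge `{u,z}` has weight `< W(e)` whenever special.  No unimodularity hypothesis is needed. [folklore] -/
theorem weight_lt_of_special_side {v w z : Ray} (hv : v.WF) (hw : w.WF) (hz : z.WF) (hδv : 0 < v.δ) (hδw : w.δ < 0)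
    (hmv : Special v z → KeyLE v z v w) (hmw : Special w z → KeyLE w z v w)
    (hs : Special (v.add w) z) : weight (v.add w) z < weight v w := by
  rcases lt_trichotomy (v.δ + w.δ) 0 with hu | hu | hu
  · exact weight_lt_of_special_side_neg hv hw hz hδv hδw hu hmw hs
  · have h0 : (v.add w).δ = 0 := by rw [add_δ]; exact hu
    exact absurd hs (not_special_of_δ_zero (add_WF hv hw) hz h0)
  · exact weight_lt_of_special_side_pos hv hw hz hδv hδw hu hmv hs

/-- `Ray.add` is commutative. [folklore] -/
theorem Ray.add_comm (v w : Ray) : v.add w = w.add v := by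
  unfold Ray.add; congr 1 <;> omega

/-- `keyLE_comm_left`: Auxiliary step of the fan-game kernel (decomp-res lens-2 g22 «DeepCrossCut» companion
FanGame.lean 16455400), VERBATIM from the lens's part file (see the module docstring); the statement is its type. [folklore] -/
theorem keyLE_comm_left {v' w' v w : Ray} : KeyLE v' w' v w ↔ KeyLE w' v' v w := by
  unfold KeyLE; rw [order_comm v' w', ssum_comm v' w']
/-- `keyLE_comm_right`: Auxiliary step of the fan-game kernel (decomp-res lens-2 g22 «DeepCrossCut» companion
FanGame.lean 16455400), VERBATIM from the lens's part file (see the module docstring); the statement is its type. [folklore] -/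
theorem keyLE_comm_right {v' w' v w : Ray} : KeyLE v' w' v w ↔ KeyLE v' w' w v := by
  unfold KeyLE; rw [order_comm v w, ssum_comm v w]

/-- (T4) LOCAL FORM, orientation-free: for a special edge `e = {v,w}` that is S3′-maximal against `{v,z}` and
`{w,z}`, each of the
three edges `{v,u}`, `{w,u}`, `{z,u}` through the new ray `u = v + w` has weight `< W(e)` whenever it is special. [folklore] -/
theorem weight_lt_of_new_edge {v w z : Ray} (hv : v.WF) (hw : w.WF) (hz : z.WF) (he : Special v w)
    (hmv : Special v z → KeyLE v z v w) (hmw : Special w z → KeyLE w z v w) :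
    (Special v (v.add w) → weight v (v.add w) < weight v w) ∧
    (Special w (v.add w) → weight w (v.add w) < weight v w) ∧
    (Special z (v.add w) → weight z (v.add w) < weight v w) := by
  rcases straddle_of_special hv hw he with ⟨hp, hn⟩ | ⟨hn, hp⟩
  · obtain ⟨h1, h2⟩ := weight_lt_of_special_endpoint hv hw hp hn he
    refine ⟨h1, fun h => ?_, fun h => ?_⟩
    · rw [special_comm] at h; rw [weight_comm]; exact h2 h
    · rw [special_comm] at h; rw [weight_comm]; exact weight_lt_of_special_side hv hw hz hp hn hmv hmw h
  · have he' : Special w v := special_comm.mp he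
    have hmw' : Special w z → KeyLE w z w v := fun h => keyLE_comm_right.mp (hmw h)
    have hmv' : Special v z → KeyLE v z w v := fun h => keyLE_comm_right.mp (hmv h)
    obtain ⟨h1, h2⟩ := weight_lt_of_special_endpoint hw hv hp hn he'
    rw [← Ray.add_comm v w, weight_comm w v] at h1 h2
    refine ⟨fun h => ?_, h1, fun h => ?_⟩
    · rw [special_comm] at h; rw [weight_comm]; exact h2 h
    · rw [special_comm] at h; rw [weight_comm]
      have := weight_lt_of_special_side hw hv hz hp hn hmw' hmv'
      rw [← Ray.add_comm v w, weight_comm w v] at this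
      exact this h


end Summit.ResolutionOfSingularities.ResolutionOfSingularities.Theorems.DeepCrossCutFanGame
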